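import Summits.QuantumAdvantage.QuantumAdvantage.Theorems.HankelLiftHankelDiscrepancy
import Summits.QuantumAdvantage.QuantumAdvantage.Theorems.HankelLiftBeyondRectanglesForsterIsotropic

/-!
# Operator norm of the Liouville Hankel pattern and the sign-rank / `THR ∘ MAJ` rung (UNCONDITIONAL)

Route `route-QuantumAdvantage-HankelLift`; support of its open hypothesis-type crux
`HankelLift.BeyondRectangles` (stmt-QuantumAdvantage-18440) — the layer-2 rungs "HankelSignRank"
and "ThrMajRung" that the route's two-layer plan files under the proved crux `HankelDiscrepancy`,
now UNCONDITIONAL thanks to the kernel proof of Forster's theorem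
(`Forster.forster_halfspaceBound`, files `…ForsterCore/Opt/Spectral/Coercive/QuantGP/Reduction/
Isotropic`).

* `bilinear_sum_le_of_symbol_bound` — weighted form of `HankelLift.rectangle_sum_le_of_symbol_bound`
  (discrete Parseval on `ℤ/(2N+s)` + Cauchy–Schwarz): `|∑_{x,y<N} u(x) f(x+y+s) v(y)| ≤ B‖u‖₂‖v‖₂`
  whenever `sup_θ ‖∑_{m ≤ 2N+s} f(m)e(mθ)‖ ≤ B`: the OPERATOR NORM of a Hankel pattern is at most
  the sup of its symbol.
* `hankel_operator_bound` — for every `C`, for all large `n`,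
  `|∑_{x,y<2^n} u(x) λ(x+y+2) v(y)| ≤ (2^n/n^C)·‖u‖₂·‖v‖₂` (Davenport, `davenport_liouville_dyadic`).
* `liouville_pair_halfspace_dim` — **HankelSignRank**: for every `C`, for all large `n`, every
  arrangement of homogeneous half spaces realizing the sign pattern of `λ(x+y+2)` on `[2^n]²` has
  dimension `≥ n^C` (superpolynomial sign-rank; by Paturi–Simon, unbounded-error communication
  complexity `ω(log n)`); `liouville_pair_signRank` is the `Matrix.rank` reading.
* `liouville_pair_not_thrOfRules` — **ThrMajRung**: for every `c`, for all large `n`, no depth-2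
  circuit whose top gate is a linear threshold gate with ARBITRARY integer weights over `s ≤ n^c`
  product-partition ("rectangle") rules `g_i(x,y) = G_i(a_i(x), b_i(y))` with `k ≤ n^c` labels
  (⊇ every majority / small-weight threshold gate of the `2n` input bits) computes
  `[λ(x+y+2) = −1]` on `[2^n]²` (dimension count `k·s + 1`).
[cite: Forster2002, Theorem 2.2]
-/

set_option linter.dupNamespace false -- D-0017: single-problem summit ⇒ `QuantumAdvantage.QuantumAdvantage` by design

noncomputable section

namespace Summit.QuantumAdvantage.QuantumAdvantage.Theorems.HankelLift

open Finset Real Filter ArithmeticFunction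
open scoped FourierTransform
open Literature.NumberTheory.Sieve.Vinogradov (afExpSum)

/-! ## The operator norm of a Hankel pattern is at most the sup of its symbol -/

/-- **Weighted Parseval on `ℤ/M`**: if `g` is injective on `T` with values in `[0, M)` and `u` is a
real weight, then `∑_{k mod M} ‖∑_{y ∈ T} u(y) e(−g(y)k/M)‖² = M·∑_{y∈T} u(y)²`. [folklore] -/
theorem sum_range_norm_sq_weighted_expSum_eq {ι : Type*} (T : Finset ι) (g : ι → ℕ) (u : ι → ℝ)
    {M : ℕ} (hg : ∀ y ∈ T, g y < M) (hinj : ∀ y ∈ T, ∀ y' ∈ T, g y = g y' → y = y') :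
    ∑ k ∈ range M, ‖∑ y ∈ T, (u y : ℂ) * (𝐞 (-((g y : ℝ) * k / M)) : ℂ)‖ ^ 2 =
      (M : ℝ) * ∑ y ∈ T, u y ^ 2 := by
  rcases Nat.eq_zero_or_pos M with hM0 | hMpos
  · subst hM0; simp
  have hM : M ≠ 0 := hMpos.ne'
  have key : ∀ k : ℕ, ((‖∑ y ∈ T, (u y : ℂ) * (𝐞 (-((g y : ℝ) * k / M)) : ℂ)‖ ^ 2 : ℝ) : ℂ) =
      ∑ y ∈ T, ∑ y' ∈ T, ((u y : ℂ) * (u y' : ℂ)) *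
        (𝐞 ((k : ℝ) * (((g y' : ℤ) - g y : ℤ) : ℝ) / M) : ℂ) := by
    intro k
    rw [← Complex.normSq_eq_norm_sq, ← Complex.mul_conj, map_sum, Finset.sum_mul_sum]
    refine Finset.sum_congr rfl fun y _ => Finset.sum_congr rfl fun y' _ => ?_
    rw [map_mul, Complex.conj_ofReal, ← Circle.coe_inv_eq_conj, ← AddChar.map_neg_eq_inv]
    rw [show (u y : ℂ) * (𝐞 (-((g y : ℝ) * k / M)) : ℂ) * ((u y' : ℂ) * (𝐞 (-(-((g y' : ℝ) * k / M))) : ℂ))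
        = ((u y : ℂ) * (u y' : ℂ)) * ((𝐞 (-((g y : ℝ) * k / M)) : ℂ) * (𝐞 (-(-((g y' : ℝ) * k / M))) : ℂ)) by ring,
      ← Circle.coe_mul, ← AddChar.map_add_eq_mul]
    congr 3
    push_cast
    ring
  have hinner : ∀ y ∈ T, ∑ k ∈ range M, ∑ y' ∈ T,
      ((u y : ℂ) * (u y' : ℂ)) * (𝐞 ((k : ℝ) * (((g y' : ℤ) - g y : ℤ) : ℝ) / M) : ℂ) =
        (M : ℂ) * ((u y : ℂ) * (u y : ℂ)) := by
    intro y hy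
    rw [Finset.sum_comm]
    have horth : ∀ y' ∈ T, ∑ k ∈ range M,
        ((u y : ℂ) * (u y' : ℂ)) * (𝐞 ((k : ℝ) * (((g y' : ℤ) - g y : ℤ) : ℝ) / M) : ℂ) =
        ((u y : ℂ) * (u y' : ℂ)) * (if ((g y' : ℤ) - g y : ℤ) = 0 then (M : ℂ) else 0) := by
      intro y' hy'
      rw [← Finset.mul_sum, sum_range_fourierChar_div_eq_ite hM]
      have h1 := hg y hy
      have h2 := hg y' hy'
      rw [abs_lt]
      constructor <;> omega
    rw [Finset.sum_congr rfl horth, Finset.sum_eq_single_of_mem y hy]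
    · simp [mul_comm]
    · intro y' hy' hne
      rw [if_neg, mul_zero]
      intro h0
      exact hne (hinj y' hy' y hy (by omega))
  have hC : ((∑ k ∈ range M, ‖∑ y ∈ T, (u y : ℂ) * (𝐞 (-((g y : ℝ) * k / M)) : ℂ)‖ ^ 2 : ℝ) : ℂ) =
      (((M : ℝ) * ∑ y ∈ T, u y ^ 2 : ℝ) : ℂ) := by
    rw [Complex.ofReal_sum, Finset.sum_congr rfl fun k _ => key k, Finset.sum_comm,
      Finset.sum_congr rfl hinner, ← Finset.mul_sum]
    push_cast
    congr 1
    exact Finset.sum_congr rfl fun y _ => by ring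
  exact_mod_cast hC

/-- **The operator norm of a Hankel pattern is at most the sup of its symbol**: for `f : ℕ → ℝ`, a
shift `s ≥ 1`, and real weights `u, v` on `[0, N)`,
`|∑_{x,y<N} u(x) f(x+y+s) v(y)| ≤ B·√(∑ u²)·√(∑ v²)` whenever `‖∑_{1 ≤ m ≤ 2N+s} f(m) e(mθ)‖ ≤ B` for
all `θ`.  Discrete Fourier expansion on `ℤ/(2N+s)` (no wrap-around since `1 ≤ x+y+s < 2N+s`),
Cauchy–Schwarz and the weighted Parseval identity; the indicator weights give back
`rectangle_sum_le_of_symbol_bound`. [cite: AroraBarak2009, Lemma 13.15 (Lindsey's lemma)] -/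
theorem bilinear_sum_le_of_symbol_bound (N s : ℕ) (hs : 1 ≤ s) (f : ℕ → ℝ) (B : ℝ)
    (hB : ∀ θ : ℝ, ‖afExpSum f (2 * N + s) θ‖ ≤ B) (u v : Fin N → ℝ) :
    |∑ x : Fin N, ∑ y : Fin N, u x * f (x.val + y.val + s) * v y| ≤
      B * Real.sqrt (∑ x, u x ^ 2) * Real.sqrt (∑ y, v y ^ 2) := by
  set M : ℕ := 2 * N + s with hMdef
  have hM0 : M ≠ 0 := by omega
  have hMpos : (0 : ℝ) < M := by positivity
  have hB0 : 0 ≤ B := (norm_nonneg _).trans (hB 0)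
  -- the weighted discrete Fourier coefficients
  set σ : ℕ → ℂ := fun k => ∑ x : Fin N, (u x : ℂ) * (𝐞 (-((x.val : ℝ) * k / M)) : ℂ) with hσ
  set τ : ℕ → ℂ := fun k => ∑ y : Fin N, (v y : ℂ) * (𝐞 (-(((y.val + s : ℕ) : ℝ) * k / M)) : ℂ)
    with hτ
  -- expansion of each summand of `∑_k F(k/M) σ(k) τ(k)`
  have hk : ∀ k : ℕ, afExpSum f M ((k : ℝ) / M) * (σ k * τ k) =
      ∑ m ∈ Icc 1 M, ∑ p : Fin N × Fin N, ((f m : ℂ) * ((u p.1 : ℂ) * (v p.2 : ℂ))) *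
        (𝐞 ((k : ℝ) * (((m : ℤ) - (p.1.val + p.2.val + s : ℕ) : ℤ) : ℝ) / M) : ℂ) := by
    intro k
    simp only [hσ, hτ, afExpSum]
    rw [Finset.sum_mul_sum, ← Finset.sum_product', Finset.sum_mul_sum]
    refine Finset.sum_congr rfl fun m _ => Finset.sum_congr rfl fun p _ => ?_
    rw [show (f m : ℂ) * (𝐞 ((m : ℝ) * ((k : ℝ) / M)) : ℂ) *
        ((u p.1 : ℂ) * (𝐞 (-((p.1.val : ℝ) * k / M)) : ℂ) *
          ((v p.2 : ℂ) * (𝐞 (-(((p.2.val + s : ℕ) : ℝ) * k / M)) : ℂ))) =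
        ((f m : ℂ) * ((u p.1 : ℂ) * (v p.2 : ℂ))) * ((𝐞 ((m : ℝ) * ((k : ℝ) / M)) : ℂ) *
          ((𝐞 (-((p.1.val : ℝ) * k / M)) : ℂ) * (𝐞 (-(((p.2.val + s : ℕ) : ℝ) * k / M)) : ℂ))) by
        ring]
    rw [← Circle.coe_mul, ← Circle.coe_mul, ← AddChar.map_add_eq_mul, ← AddChar.map_add_eq_mul]
    congr 3
    push_cast
    ring
  -- the identity `∑_k F(k/M) σ(k) τ(k) = M · ∑ u f v`
  have hident : ∑ k ∈ range M, afExpSum f M ((k : ℝ) / M) * (σ k * τ k) =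
      (M : ℂ) * ∑ p : Fin N × Fin N, ((u p.1 : ℂ) * (f (p.1.val + p.2.val + s) : ℂ) * (v p.2 : ℂ)) := by
    simp_rw [hk]
    rw [Finset.sum_comm]
    refine (Finset.sum_congr rfl fun m _ => Finset.sum_comm).trans ?_
    rw [Finset.sum_comm, Finset.mul_sum]
    refine Finset.sum_congr rfl fun p _ => ?_
    have horth : ∀ m ∈ Icc 1 M, ∑ k ∈ range M, ((f m : ℂ) * ((u p.1 : ℂ) * (v p.2 : ℂ))) *
        (𝐞 ((k : ℝ) * (((m : ℤ) - (p.1.val + p.2.val + s : ℕ) : ℤ) : ℝ) / M) : ℂ) =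
        ((f m : ℂ) * ((u p.1 : ℂ) * (v p.2 : ℂ))) *
          (if ((m : ℤ) - (p.1.val + p.2.val + s : ℕ) : ℤ) = 0 then (M : ℂ) else 0) := by
      intro m hm
      rw [← Finset.mul_sum, sum_range_fourierChar_div_eq_ite hM0]
      obtain ⟨hm1, hmM⟩ := Finset.mem_Icc.mp hm
      have hx' := p.1.isLt
      have hy' := p.2.isLt
      rw [abs_lt]
      push_cast
      constructor <;> omega
    rw [Finset.sum_congr rfl horth,
      Finset.sum_eq_single_of_mem (p.1.val + p.2.val + s)
        (Finset.mem_Icc.mpr ⟨by omega, by have := p.1.isLt; have := p.2.isLt; omega⟩)]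
    · rw [if_pos (by simp)]; ring
    · intro m _ hne
      rw [if_neg (by push_cast; omega), mul_zero]
  -- Parseval for `σ` and `τ`
  have hσP : ∑ k ∈ range M, ‖σ k‖ ^ 2 = (M : ℝ) * ∑ x : Fin N, u x ^ 2 :=
    sum_range_norm_sq_weighted_expSum_eq Finset.univ (fun x : Fin N => x.val) u
      (fun x _ => by omega) (fun x _ x' _ h => Fin.ext h)
  have hτP : ∑ k ∈ range M, ‖τ k‖ ^ 2 = (M : ℝ) * ∑ y : Fin N, v y ^ 2 :=
    sum_range_norm_sq_weighted_expSum_eq Finset.univ (fun y : Fin N => y.val + s) v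
      (fun y _ => by omega) (fun y _ y' _ h => Fin.ext (by omega))
  -- the bound
  have hbound : ‖∑ k ∈ range M, afExpSum f M ((k : ℝ) / M) * (σ k * τ k)‖ ≤
      B * ((M : ℝ) * (Real.sqrt (∑ x, u x ^ 2) * Real.sqrt (∑ y, v y ^ 2))) := by
    calc ‖∑ k ∈ range M, afExpSum f M ((k : ℝ) / M) * (σ k * τ k)‖
        ≤ ∑ k ∈ range M, ‖afExpSum f M ((k : ℝ) / M) * (σ k * τ k)‖ := norm_sum_le _ _
      _ ≤ ∑ k ∈ range M, B * (‖σ k‖ * ‖τ k‖) := by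
          refine Finset.sum_le_sum fun k _ => ?_
          rw [norm_mul, norm_mul]
          exact mul_le_mul_of_nonneg_right (hB _) (by positivity)
      _ = B * ∑ k ∈ range M, ‖σ k‖ * ‖τ k‖ := by rw [Finset.mul_sum]
      _ ≤ B * (Real.sqrt (∑ k ∈ range M, ‖σ k‖ ^ 2) * Real.sqrt (∑ k ∈ range M, ‖τ k‖ ^ 2)) :=
          mul_le_mul_of_nonneg_left (Real.sum_mul_le_sqrt_mul_sqrt _ _ _) hB0
      _ = B * ((M : ℝ) * (Real.sqrt (∑ x, u x ^ 2) * Real.sqrt (∑ y, v y ^ 2))) := by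
          rw [hσP, hτP, Real.sqrt_mul hMpos.le, Real.sqrt_mul hMpos.le]
          have hsq : Real.sqrt (M : ℝ) * Real.sqrt (M : ℝ) = M := Real.mul_self_sqrt hMpos.le
          rw [show Real.sqrt (M : ℝ) * Real.sqrt (∑ x, u x ^ 2) * (Real.sqrt (M : ℝ) * Real.sqrt (∑ y, v y ^ 2))
              = (Real.sqrt (M : ℝ) * Real.sqrt (M : ℝ)) * (Real.sqrt (∑ x, u x ^ 2) * Real.sqrt (∑ y, v y ^ 2))
              by ring, hsq]
  -- conclusion
  have hnorm : ‖∑ k ∈ range M, afExpSum f M ((k : ℝ) / M) * (σ k * τ k)‖ =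
      (M : ℝ) * |∑ x : Fin N, ∑ y : Fin N, u x * f (x.val + y.val + s) * v y| := by
    rw [hident, norm_mul, Complex.norm_natCast, Fintype.sum_prod_type]
    have hcast : (∑ x : Fin N, ∑ y : Fin N,
        (u x : ℂ) * (f (x.val + y.val + s) : ℂ) * (v y : ℂ)) =
        ((∑ x : Fin N, ∑ y : Fin N, u x * f (x.val + y.val + s) * v y : ℝ) : ℂ) := by
      push_cast; rfl
    rw [hcast, Complex.norm_real, Real.norm_eq_abs]
  rw [hnorm] at hbound
  have h2 : (M : ℝ) * |∑ x : Fin N, ∑ y : Fin N, u x * f (x.val + y.val + s) * v y| ≤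
      (M : ℝ) * (B * Real.sqrt (∑ x, u x ^ 2) * Real.sqrt (∑ y, v y ^ 2)) :=
    hbound.trans_eq (by ring)
  exact le_of_mul_le_mul_left h2 hMpos

/-- **Operator norm of the Liouville Hankel pattern**: for every `C`, for all large `n`, all real
`u, v : [2^n] → ℝ` satisfy `|∑_{x,y} u(x) λ(x+y+2) v(y)| ≤ (2^n/n^C)·√(∑u²)·√(∑v²)` (Davenport's
bound `davenport_liouville_dyadic` through `bilinear_sum_le_of_symbol_bound`).
[cite: MontgomeryVaughan2007, §11.3 Exercise 13(f) p. 384] -/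
theorem hankel_operator_bound (C : ℕ) : ∀ᶠ n : ℕ in atTop, ∀ u v : Fin (2 ^ n) → ℝ,
    |∑ x : Fin (2 ^ n), ∑ y : Fin (2 ^ n),
        u x * ((liouville (x.val + y.val + 2) : ℤ) : ℝ) * v y| ≤
      (2 : ℝ) ^ n / (n : ℝ) ^ C * Real.sqrt (∑ x, u x ^ 2) * Real.sqrt (∑ y, v y ^ 2) := by
  filter_upwards [davenport_liouville_dyadic C] with n hDn u v
  have h := bilinear_sum_le_of_symbol_bound (2 ^ n) 2 (by norm_num)
    (⇑(liouville : ArithmeticFunction ℝ)) _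
    (fun θ => by simpa [two_mul, pow_succ, mul_comm] using hDn θ) u v
  simpa only [intCoe_apply] using h

/-! ## The sign-rank / `THR ∘ MAJ` rung (unconditional, via Forster's theorem) -/

/-- **HankelSignRank, half-space form (unconditional).**  For every `C`, for all large `n`: every
arrangement of homogeneous half spaces `u_x, v_y ∈ ℝ^ι` realizing the sign pattern of the Liouville
Hankel matrix, `sign⟨u_x, v_y⟩ = λ(x+y+2)` on `[2^n]²`, has dimension `|ι| ≥ n^C` (Forster's theorem
`Forster.forster_halfspaceBound` with `‖(λ(x+y+2))_{x,y}‖ ≤ 2^n/n^C` from `hankel_operator_bound`).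
By Paturi–Simon: the unbounded-error communication complexity of `λ(x+y+2)` is `ω(log n)`.
[cite: Forster2002, Theorem 2.2] -/
theorem liouville_pair_halfspace_dim (C : ℕ) :
    ∀ᶠ n : ℕ in atTop, ∀ (ι : Type) [Fintype ι] (u v : Fin (2 ^ n) → ι → ℝ),
      (∀ x y : Fin (2 ^ n),
        0 < ((liouville (x.val + y.val + 2) : ℤ) : ℝ) * ∑ l, u x l * v y l) →
      (n : ℝ) ^ C ≤ Fintype.card ι := by
  filter_upwards [hankel_operator_bound C, eventually_ge_atTop 1] with n hop hn1 ι _ u v hsign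
  have hpm : ∀ x y : Fin (2 ^ n), ((liouville (x.val + y.val + 2) : ℤ) : ℝ) = 1 ∨
      ((liouville (x.val + y.val + 2) : ℤ) : ℝ) = -1 := by
    intro x y
    rw [liouville_apply (by omega)]
    rcases neg_one_pow_eq_or ℤ (cardFactors (x.val + y.val + 2)) with h | h <;> simp [h]
  have h := Forster.forster_halfspaceBound (Fin (2 ^ n)) (Fin (2 ^ n)) ι
    (fun x y => ((liouville (x.val + y.val + 2) : ℤ) : ℝ)) u v ((2 : ℝ) ^ n / (n : ℝ) ^ C)
    (by positivity) hpm hsign hop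
  rw [Fintype.card_fin] at h
  push_cast at h
  rw [Real.sqrt_mul_self (by positivity)] at h
  -- `2^n ≤ 2^n / n^C * |ι|` ⇒ `n^C ≤ |ι|`
  have hn0 : (0 : ℝ) < (n : ℝ) ^ C := by positivity
  have h2 : (0 : ℝ) < (2 : ℝ) ^ n := by positivity
  rw [div_mul_eq_mul_div, le_div_iff₀ hn0] at h
  nlinarith

/-- **HankelSignRank, rank form (unconditional).**  For every `C`, for all large
`n`: every real matrix `P` on `[2^n]²` that SIGN-REPRESENTS the Liouville Hankel pattern
(`P_{xy}·λ(x+y+2) > 0` for all `x, y`) has `rank P ≥ n^C` — the sign-rank of `(λ(x+y+2))_{x,y<2^n}`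
is superpolynomial in `n`.  (A rank-`r` matrix factors through `ℝ^r` by a basis of its column
space, giving an arrangement of half spaces in dimension `r`; then `liouville_pair_halfspace_dim`.)
[cite: Forster2002, Theorem 2.2] -/
theorem liouville_pair_signRank (C : ℕ) :
    ∀ᶠ n : ℕ in atTop, ∀ P : Matrix (Fin (2 ^ n)) (Fin (2 ^ n)) ℝ,
      (∀ x y : Fin (2 ^ n), 0 < ((liouville (x.val + y.val + 2) : ℤ) : ℝ) * P x y) →
      (n : ℝ) ^ C ≤ P.rank := by
  filter_upwards [liouville_pair_halfspace_dim C] with n hn P hsign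
  classical
  -- factor `P` through its column space
  set W : Submodule ℝ (Fin (2 ^ n) → ℝ) := LinearMap.range P.mulVecLin with hW
  let bW := Module.finBasis ℝ W
  have hcol : ∀ y : Fin (2 ^ n), P.mulVecLin (Pi.single y 1) ∈ W := fun y => LinearMap.mem_range_self _ _
  let u : Fin (2 ^ n) → Fin (Module.finrank ℝ W) → ℝ := fun x l => (bW l : Fin (2 ^ n) → ℝ) x
  let v : Fin (2 ^ n) → Fin (Module.finrank ℝ W) → ℝ := fun y l => bW.repr ⟨_, hcol y⟩ l
  have huv : ∀ x y : Fin (2 ^ n), ∑ l, u x l * v y l = P x y := by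
    intro x y
    have hrepr := bW.sum_repr ⟨_, hcol y⟩
    have hx := congrArg (fun f : W => (f : Fin (2 ^ n) → ℝ) x) hrepr
    simp only [Submodule.coe_sum, Submodule.coe_smul, Finset.sum_apply, Pi.smul_apply,
      smul_eq_mul] at hx
    have hc : (P.mulVecLin (Pi.single y 1)) x = P x y := by
      rw [Matrix.mulVecLin_apply, Matrix.mulVec_single_one, Matrix.col_apply]
    rw [← hx.trans hc]
    exact Finset.sum_congr rfl fun l _ => mul_comm _ _
  have h := hn (Fin (Module.finrank ℝ W)) u v (fun x y => by rw [huv]; exact hsign x y)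
  rwa [Fintype.card_fin] at h

/-- **ThrMajRung (unconditional): no `THR ∘ (rectangle rules)` circuit of polynomial size
computes the lifted Liouville witness.**  For every `c`, for all large `n`: for all
`s, k ≤ n^c`, every depth-2 circuit whose top gate is a linear threshold gate `[w₀ ≤ ∑ᵢ wᵢ gᵢ]`
with ARBITRARY integer weights, over `s` bottom gates each of which is a product-partition rule
`gᵢ(x,y) = Gᵢ(aᵢ(x), bᵢ(y))` with `k` labels a side (`aᵢ, bᵢ : [2^n] → [k]`, `Gᵢ : [k]² → {0,1}`;
every majority / weight-`W` threshold gate of the `2n` input bits is such a rule with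
`k = 2nW + 1`), differs from `[λ(x+y+2) = −1]` somewhere on `[2^n]²`.  The circuit yields an
arrangement of half spaces in dimension `s·k + 1` (coordinates `(i, ℓ) ↦ wᵢ·Gᵢ(aᵢ(x), ℓ)` against
`[bᵢ(y) = ℓ]`, plus one coordinate for the threshold shifted by `½`) realizing the sign pattern, and
`s·k + 1 ≤ n^{2c} + 1 < n^{2c+2}` contradicts `liouville_pair_halfspace_dim` — the
Forster–Krause–Lokam–Mubarakzjanov–Schmitt–Simon dimension count for `THR ∘ MAJ`.
[cite: Forster2002, Theorem 2.2] -/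
theorem liouville_pair_not_thrOfRules (c : ℕ) :
    ∀ᶠ n : ℕ in atTop, ∀ s : ℕ, s ≤ n ^ c → ∀ k : ℕ, k ≤ n ^ c →
      ∀ (a b : Fin s → Fin (2 ^ n) → Fin k) (G : Fin s → Fin k → Fin k → Bool)
        (w : Fin s → ℤ) (w₀ : ℤ),
      ∃ p : Fin (2 ^ n) × Fin (2 ^ n),
        decide (w₀ ≤ ∑ i, if G i (a i p.1) (b i p.2) then w i else 0) ≠
          decide (liouville (p.1.val + p.2.val + 2) = -1) := by
  filter_upwards [liouville_pair_halfspace_dim (2 * c + 2), eventually_ge_atTop 2] with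
    n hdim hn2 s hs k hk a b G w w₀
  by_contra hall
  push Not at hall
  classical
  -- the arrangement of half spaces in dimension `s·k + 1`
  let u : Fin (2 ^ n) → (Fin s × Fin k) ⊕ Unit → ℝ := fun x j =>
    match j with
    | Sum.inl (i, l) => if G i (a i x) l then (-(w i : ℝ)) else 0
    | Sum.inr _ => (w₀ : ℝ) - 1 / 2
  let v : Fin (2 ^ n) → (Fin s × Fin k) ⊕ Unit → ℝ := fun y j =>
    match j with
    | Sum.inl (i, l) => if b i y = l then 1 else 0
    | Sum.inr _ => 1
  have huv : ∀ x y : Fin (2 ^ n), ∑ j, u x j * v y j =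
      -(((∑ i, if G i (a i x) (b i y) then w i else 0 : ℤ) : ℝ) - w₀ + 1 / 2) := by
    intro x y
    rw [Fintype.sum_sum_type, Fintype.sum_prod_type]
    simp only [u, v, Finset.sum_const, Finset.card_univ, Fintype.card_unit, one_smul, mul_one]
    have hi : ∀ i : Fin s, ∑ l : Fin k, (if G i (a i x) l then (-(w i : ℝ)) else 0) *
        (if b i y = l then 1 else 0) = -(if G i (a i x) (b i y) then (w i : ℝ) else 0) := by
      intro i
      rw [Finset.sum_eq_single (b i y)]
      · simp only [if_true, mul_one]
        split_ifs <;> simp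
      · intro l _ hl
        rw [if_neg (Ne.symm hl), mul_zero]
      · intro h; exact absurd (Finset.mem_univ _) h
    rw [Finset.sum_congr rfl fun i _ => hi i, Finset.sum_neg_distrib]
    push_cast
    rw [show (∑ i : Fin s, (if G i (a i x) (b i y) then (w i : ℝ) else 0)) =
        ∑ i : Fin s, ((if G i (a i x) (b i y) then w i else 0 : ℤ) : ℝ) from
      Finset.sum_congr rfl fun i _ => by split_ifs <;> simp]
    ring
  -- it realizes the sign pattern of `λ(x+y+2)`
  have hsign : ∀ x y : Fin (2 ^ n),
      0 < ((liouville (x.val + y.val + 2) : ℤ) : ℝ) * ∑ j, u x j * v y j := by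
    intro x y
    rw [huv]
    have h := hall (x, y)
    rw [decide_eq_decide] at h
    simp only at h
    set S : ℤ := ∑ i, if G i (a i x) (b i y) then w i else 0 with hS
    by_cases hle : w₀ ≤ S
    · have hl : liouville (x.val + y.val + 2) = -1 := h.mp hle
      have hle' : (w₀ : ℝ) ≤ S := by exact_mod_cast hle
      rw [hl]; push_cast; nlinarith
    · have hl : ((liouville (x.val + y.val + 2) : ℤ) : ℝ) = 1 := by
        rw [liouville_apply (by omega)] at h ⊢
        rcases neg_one_pow_eq_or ℤ (cardFactors (x.val + y.val + 2)) with h1 | h1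
        · simp [h1]
        · exact absurd (h.mpr h1) hle
      have hlt' : (S : ℝ) + 1 ≤ w₀ := by
        have : S + 1 ≤ w₀ := Int.add_one_le_iff.mpr (not_le.mp hle)
        exact_mod_cast this
      rw [hl]; nlinarith
  -- Forster: `n^{2c+2} ≤ s·k + 1`
  have h := hdim ((Fin s × Fin k) ⊕ Unit) u v hsign
  simp only [Fintype.card_sum, Fintype.card_prod, Fintype.card_fin, Fintype.card_unit] at h
  push_cast at h
  -- but `s·k + 1 ≤ n^{2c} + 1 < n^{2c+2}`
  have hs' : (s : ℝ) ≤ (n : ℝ) ^ c := by exact_mod_cast hs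
  have hk' : (k : ℝ) ≤ (n : ℝ) ^ c := by exact_mod_cast hk
  have hn2' : (2 : ℝ) ≤ n := by exact_mod_cast hn2
  have hsk : (s : ℝ) * k ≤ (n : ℝ) ^ (2 * c) := by
    rw [show (n : ℝ) ^ (2 * c) = (n : ℝ) ^ c * (n : ℝ) ^ c by rw [← pow_add]; ring_nf]
    exact mul_le_mul hs' hk' (by positivity) (by positivity)
  have hX1 : (1 : ℝ) ≤ (n : ℝ) ^ (2 * c) := one_le_pow₀ (by linarith)
  have hpow : (n : ℝ) ^ (2 * c + 2) = (n : ℝ) ^ (2 * c) * ((n : ℝ) * n) := by ring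
  rw [hpow] at h
  nlinarith [mul_le_mul_of_nonneg_left (show (4 : ℝ) ≤ (n : ℝ) * n by nlinarith)
    (by positivity : (0 : ℝ) ≤ (n : ℝ) ^ (2 * c))]

end Summit.QuantumAdvantage.QuantumAdvantage.Theorems.HankelLift
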